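import Literature.NumberTheory.LFunctions.WeilArchDensityTail
import Literature.Analysis.ValidatedNumerics.TaylorModelMovingIntegral
import HarnessLib

/-!
# The archimedean density of Weil's explicit formula, V: the tail `Ψ(t_j + λ)` as a Taylor model from panel data

Topic `Literature/NumberTheory/LFunctions` (sequel of `WeilArchDensityTail.lean`, consumer of
`Literature/Analysis/ValidatedNumerics/TaylorModelMovingIntegral.lean`).  On the grid `t_j = (2j+1)h` the tail
`Ψ(L) = ∫_{(L,∞)} ρ` of the archimedean density at a point `L = t_j + λ`, `|λ| ≤ h`, `j ≥ 1`, is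

  `Ψ(t_j + λ) = Ψ(T) + ∫_{2jh}^{T} ρ − ∫_{-h}^{λ} ρ(t_j + u) du`,   `T = 2Nh` the right end of the panelled range,

(`weilArchTail_sub_eq_integral`), i.e. a CONSTANT (an enclosure `PsiFar` of `Ψ(T)` plus the full panels `j, …, N−1` of `ρ`,
`PolyMP.fullPanelsI`) minus the partial panel `j` (`PolyMP.partPanelTM`).  Given Taylor models of `u ↦ ρ(t_i + u)` on the panels
`i ≥ 1` (data `Dρ : List (IPoly × Poly)`; panel `0` is never used — `ρ ~ 1/(2t)` there) and `PsiFar`, the kernel-computable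
`weilArchTailTM` encloses `λ ↦ Ψ(t_j + λ)` (`tmem_weilArchTailTM`).  This is the factor `Ψ(c ∓ y)` of the window image of a windowed
trial vector on every y-panel except the edge one (where `Ψ = −½ log + Ψ̃`, `WeilArchDensityTail.weilArchTail_eq_log`).
All proved; no named facts.

## References
* E. Bombieri, Rend. Mat. Acc. Lincei (9) 11 (2000) 183–233, Thm 2 (the density). [Bombieri2000Weil]
* K. Makino, M. Berz, Int. J. Pure Appl. Math. 4 (2003) 379–456 (Taylor models). [folklore]
-/

noncomputable section

open Real Set MeasureTheory Filter intervalIntegral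
open scoped Topology Interval

namespace Literature.NumberTheory.LFunctions

open Literature.Analysis.ValidatedNumerics Literature.Analysis.ValidatedNumerics.PolyMP
  Literature.Analysis.ValidatedNumerics.NumericsMP Literature.Analysis.ValidatedNumerics.ExpPoly

/-! ## The density cut off below `h` (a technical device: integrable on every `[a, b] ⊂ [0, ∞)`) -/

/-- `ρ` cut off below `h`: `ρ_h = 𝟙_{[h,∞)} ρ`. [folklore] -/
def weilArchDensityCut (h : ℝ) : ℝ → ℝ := (Ici h).indicator weilArchDensity

/-- `ρ` is continuous on `(0, ∞)`. [folklore] -/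
theorem continuousOn_weilArchDensity : ContinuousOn weilArchDensity (Ioi 0) := by
  refine ContinuousOn.div (by fun_prop) (by fun_prop) fun t ht ↦ ?_
  exact mul_ne_zero two_ne_zero (Real.sinh_pos_iff.2 (mem_Ioi.1 ht)).ne'

/-- The cut density is interval integrable on every `[a, b]` (for `h > 0`). [folklore] -/
theorem intervalIntegrable_weilArchDensityCut {h : ℝ} (hh : 0 < h) (a b : ℝ) :
    IntervalIntegrable (weilArchDensityCut h) volume a b := by
  -- `ρ_h` is the restriction to `[h, ∞)` of a function continuous there; on any compact interval it is bounded and measurable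
  wlog hab : a ≤ b generalizing a b
  · exact (this b a (le_of_not_ge hab)).symm
  rw [intervalIntegrable_iff_integrableOn_Icc_of_le hab]
  have hcont : ContinuousOn weilArchDensity (Icc (max a h) b ∩ Ici h) :=
    continuousOn_weilArchDensity.mono fun t ht ↦ lt_of_lt_of_le hh ht.2
  have h1 : IntegrableOn weilArchDensity (Icc (max a h) b) := by
    refine (ContinuousOn.integrableOn_Icc (continuousOn_weilArchDensity.mono fun t ht ↦ ?_))
    exact lt_of_lt_of_le hh ((le_max_right a h).trans ht.1)
  have h2 : IntegrableOn (weilArchDensityCut h) (Icc (max a h) b) :=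
    (h1.indicator measurableSet_Ici)
  -- on `[a, b] \ [max a h, b]` the cut density vanishes
  have h3 : IntegrableOn (weilArchDensityCut h) (Icc a b \ Icc (max a h) b) := by
    refine (integrableOn_zero).congr_fun (fun t ht ↦ ?_) (measurableSet_Icc.diff measurableSet_Icc)
    have hth : t ∉ Ici h := by
      intro (hth : h ≤ t)
      exact ht.2 ⟨max_le ht.1.1 hth, ht.1.2⟩
    simp [weilArchDensityCut, indicator_of_notMem hth]
  have h4 := h2.union h3
  exact h4.mono_set (by
    intro t ht
    by_cases hm : t ∈ Icc (max a h) b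
    · exact Or.inl hm
    · exact Or.inr ⟨ht, hm⟩)

/-- On `[h, ∞)` the cut density is the density. [folklore] -/
theorem weilArchDensityCut_of_le {h t : ℝ} (ht : h ≤ t) : weilArchDensityCut h t = weilArchDensity t :=
  indicator_of_mem (mem_Ici.2 ht) _

/-! ## The kernel object -/

/-- Taylor model of `λ ↦ Ψ(t_j + λ)`: `PsiFar + Σ_{i=j}^{N−1} ∫_{panel i} ρ − ∫_{-h}^{λ} ρ(t_j+u) du`, from the panel data `Dρ`
(length `N`, entry `i` = Taylor model and reference polynomial of `u ↦ ρ(t_i + u)`, `i ≥ 1`) and an enclosure `PsiFar` of `Ψ(2Nh)`.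
[folklore] -/
def weilArchTailTM (S : ℕ) (h : ℚ) (Dρ : List (IPoly × Poly)) (j : ℕ) (PsiFar : MI) : IPoly :=
  taddI (tconst (MI.add PsiFar (fullPanelsI S h [1] (Dρ.drop j) j)))
    (tnegI (partPanelTM S h (Dρ.getD j ([], [])).1 (Dρ.getD j ([], [])).2 [1]))

/-- **The tail on the grid as a Taylor model.**  Let `0 < h`, `1 ≤ j < N = Dρ.length`, Taylor models of `u ↦ ρ(t_i + u)`
on `|u| ≤ h` for the panels `1 ≤ i < N`, and `Ψ(2Nh) ∈ PsiFar`.  Then `weilArchTailTM` encloses `λ ↦ Ψ(t_j + λ)` on `|λ| ≤ h`.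
[cite: Bombieri2000Weil, Thm 2 (the density)] -/
theorem tmem_weilArchTailTM {S : ℕ} (hS : 0 < S) {h : ℚ} (hh : 0 < h) (Dρ : List (IPoly × Poly)) {j : ℕ}
    (hj1 : 1 ≤ j) (hjN : j < Dρ.length)
    (hD : ∀ i : Fin Dρ.length, 1 ≤ (i : ℕ) →
      TMem S h (fun u ↦ weilArchDensity ((panelCentre h i : ℝ) + u)) (Dρ.get i).1)
    {PsiFar : MI} (hFar : MI.mem S (weilArchTail (2 * Dρ.length * h)) PsiFar) :
    TMem S h (fun lam ↦ weilArchTail ((panelCentre h j : ℝ) + lam)) (weilArchTailTM S h Dρ j PsiFar) := by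
  have hhr : (0 : ℝ) < h := by exact_mod_cast hh
  set N := Dρ.length with hN
  have hj0 : (1 : ℝ) ≤ j := by exact_mod_cast hj1
  have hjN' : (j : ℝ) + 1 ≤ N := by exact_mod_cast hjN
  -- the cut density agrees with `ρ` on every panel `i ≥ 1`
  have hw : ∀ a b : ℝ, 0 ≤ a → a ≤ b → IntervalIntegrable (weilArchDensityCut h) volume a b :=
    fun a b _ _ ↦ intervalIntegrable_weilArchDensityCut hhr a b
  have hDcut : ∀ i : Fin (Dρ.drop j).length,
      TMem S h (fun u ↦ weilArchDensityCut h ((panelCentre h (j + i) : ℝ) + u)) ((Dρ.drop j).get i).1 := by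
    intro i
    have hi : j + (i : ℕ) < Dρ.length := by have := i.2; simp only [List.length_drop] at this; omega
    have e : (Dρ.drop j).get i = Dρ.get ⟨j + i, hi⟩ := by simp [List.get_eq_getElem, List.getElem_drop]
    rw [e]
    intro u hu
    obtain ⟨as, has, ev⟩ := hD ⟨j + i, hi⟩ (by simp; omega) u hu
    refine ⟨as, has, ?_⟩
    rw [← ev]
    beta_reduce
    rw [weilArchDensityCut_of_le]
    have : ((panelCentre h (j + i) : ℚ) : ℝ) = (2 * ((j : ℝ) + i) + 1) * h := by simp [panelCentre]
    rw [this]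
    have hi0 : (0 : ℝ) ≤ i := by exact_mod_cast Nat.zero_le _
    nlinarith [abs_le.1 hu]
  -- full panels `j, …, N−1` of the cut density
  have hfull := mem_fullPanelsI hS hh.le hw [1] (Dρ.drop j) j hDcut
  have hlenD : (j : ℝ) + ((Dρ.drop j).length : ℝ) = N := by
    rw [List.length_drop, Nat.cast_sub hjN.le]; ring
  -- the partial panel
  have hget : Dρ.getD j ([], []) = Dρ.get ⟨j, hjN⟩ := List.getD_eq_get _ ([], []) ⟨j, hjN⟩
  have hWj : TMem S h (fun u ↦ weilArchDensity ((panelCentre h j : ℝ) + u)) (Dρ.getD j ([], [])).1 := by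
    rw [hget]; exact hD ⟨j, hjN⟩ hj1
  have hcj : ((panelCentre h j : ℚ) : ℝ) = (2 * j + 1) * h := by simp [panelCentre]
  have hfi : IntervalIntegrable (fun u ↦ weilArchDensity ((panelCentre h j : ℝ) + u)) volume (-(h : ℝ)) h := by
    refine (ContinuousOn.intervalIntegrable ?_)
    refine continuousOn_weilArchDensity.comp (by fun_prop) fun u hu ↦ ?_
    rw [uIcc_of_le (by linarith)] at hu
    show 0 < ((panelCentre h j : ℚ) : ℝ) + u
    rw [hcj]; nlinarith [hu.1]
  have hpart := tmem_partPanelTM hS hh.le hWj hfi (Dρ.getD j ([], [])).2 [1]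
  -- assemble
  intro lam hlam
  have hl := abs_le.1 hlam
  set L : ℝ := (panelCentre h j : ℝ) + lam with hL
  have hL0 : 2 * h ≤ L := by rw [hL, hcj]; nlinarith
  have hLpos : 0 < L := by linarith
  have hLT : L ≤ 2 * N * h := by rw [hL, hcj]; nlinarith
  -- `Ψ(L) = Ψ(T) + ∫_L^T ρ`
  have e1 : weilArchTail L = weilArchTail (2 * N * h) + ∫ t in L..(2 * N * h), weilArchDensity t := by
    have := weilArchTail_sub_eq_integral hLpos hLT
    linarith
  -- `∫_L^T ρ = ∫_{2jh}^T ρ_h − ∫_{2jh}^{L} ρ` and the shift of the partial panel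
  have hρint : ∀ a b : ℝ, 2 * h ≤ a → a ≤ b → IntervalIntegrable weilArchDensity volume a b := by
    intro a b ha hab
    refine ContinuousOn.intervalIntegrable (continuousOn_weilArchDensity.mono fun t ht ↦ ?_)
    rw [uIcc_of_le hab] at ht
    exact lt_of_lt_of_le (by linarith) ht.1
  have e2 : ∫ t in L..(2 * N * h), weilArchDensity t =
      (∫ t in (2 * j * h : ℝ)..(2 * (j + (Dρ.drop j).length) * h : ℝ), weilArchDensityCut h t * Poly.eval [1] t) -
        ∫ u in (-(h : ℝ))..lam, weilArchDensity ((panelCentre h j : ℝ) + u) * Poly.eval [1] u := by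
    have hjh : 2 * h ≤ 2 * (j : ℝ) * h := by nlinarith
    rw [hlenD]
    have ecut : ∫ t in (2 * j * h : ℝ)..(2 * N * h : ℝ), weilArchDensityCut h t * Poly.eval [1] t =
        ∫ t in (2 * j * h : ℝ)..(2 * N * h : ℝ), weilArchDensity t := by
      refine intervalIntegral.integral_congr fun t ht ↦ ?_
      rw [uIcc_of_le (by nlinarith)] at ht
      simp only [Poly.eval, Rat.cast_one, mul_zero, add_zero, mul_one]
      exact weilArchDensityCut_of_le (by linarith [ht.1])
    have eshift : ∫ u in (-(h : ℝ))..lam, weilArchDensity ((panelCentre h j : ℝ) + u) * Poly.eval [1] u =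
        ∫ t in (2 * j * h : ℝ)..L, weilArchDensity t := by
      have hs := intervalIntegral.integral_comp_add_left (fun t ↦ weilArchDensity t) ((panelCentre h j : ℝ))
        (a := -(h : ℝ)) (b := lam)
      simp only [Poly.eval, Rat.cast_one, mul_zero, add_zero, mul_one]
      rw [hs, hL, hcj]
      congr 1; ring
    rw [ecut, eshift, ← integral_add_adjacent_intervals (hρint _ _ hjh (by rw [hL, hcj]; nlinarith))
      (hρint _ _ hL0 hLT)]
    ring
  obtain ⟨as, has, ev⟩ := (tmem_add (tmem_const (h := h) (MI.mem_add hFar hfull)) (tmem_neg hpart)) lam hlam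
  refine ⟨as, has, ?_⟩
  rw [← ev]
  beta_reduce
  rw [← hL, e1, e2]
  ring

end Literature.NumberTheory.LFunctions

end
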